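import Mathlib.Analysis.CStarAlgebra.Matrix
import Mathlib.Algebra.Order.BigOperators.Ring.Finset
import HarnessLib

/-!
# Ventures/CertifiedManyBodySolver — Upper/IntervalReaderSchur.lean: the Schur test and the rounding-defect bound
(Theorem H1′ of the interval reader, part 1 of 3: `IntervalReaderSchur` → `IntervalReaderTransfer` → `IntervalReaderH1`)

HONEST FRAMING: first certified bounds; not a superconductivity verdict; every number certified or labelled
float.  This file bounds A READER'S OWN ROUNDING; it says nothing about the Hubbard model, a producer, a row,
or the thermodynamic limit.

Source (prose, read against the code): `HOME/sr-mbsolver-ird-2/pages/THEOREM-H1PRIME-PROOF-NOTE.md` (ird-2 g0,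
sha16 954c3f3b30371ea8; E1-READER-PACKET §3 EDITION TODO 4; referee R2.63 (γ′)), describing `l3core/h1sweep.py`
of the Theorem-H1′ INTERVAL reader (binary of record `l3core 0.6.8`).  This part supplies the two
operator-norm constants of the reader's radius recursion, in the tree's vocabulary (Mathlib's `L²` operator norm
on `Matrix m n 𝕜`, scoped instance `Matrix.Norms.L2Operator`):

* `sum_sq_sum_mul_le` (real core) / `norm_toLp_mulVec_le_of_row_col` / `l2_opNorm_le_sqrt_row_mul_col` — the
  SCHUR TEST: absolute row sums `≤ R` and absolute column sums `≤ C` give `‖B‖₂ ≤ √(R·C)`, hence `≤ max (R, C)`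
  (`l2_opNorm_le_max_row_col`, `sqrt_mul_le_max`) — the constant `opnorm_bound(O) = max(‖O‖₁, ‖O‖_∞)` of
  `h1sweep.py`;
* `l2_opNorm_le_of_forall_norm_entry_le` — a ROUNDING DEFECT with entries of modulus `≤ ε` on an `m × n` block has
  `‖·‖₂ ≤ √(#m·#n)·ε` (the code's `rho = χ·2^(−P−1)` per square block and `rho1_one = √(χ_x χ_{x+1})·2^(−P−1)` per
  intermediate block, nearest rounding to `2^(−P)·ℤ` giving `ε = 2^(−P−1)`);
* `norm_entry_le_l2_opNorm` / `norm_entry_sub_le_of_norm_sub_le` — an entry is bounded by the operator norm, so a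
  radius on a final `1 × 1` environment IS the enclosure `|B̂ − B| ≤ r_n` / `|ĥ − den·A| ≤ r_h` the verdict reads.

Elementary (Cauchy–Schwarz); no claim about the Hubbard model.
-/

noncomputable section

open Matrix Finset WithLp
open scoped BigOperators ComplexOrder

namespace Summit.Ventures.CertifiedManyBodySolver.Upper.IntervalReader

/-! ## §B  The Schur test and the rounding-defect bound -/

/-- **Schur test, real core.**  Non-negative weights `O i j` with row sums `≤ R` and column sums `≤ C`
(`0 ≤ R`): for every real vector `b`, `Σ_i (Σ_j O i j · b j)² ≤ R · C · Σ_j (b j)²`.  (Cauchy–Schwarz with the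
weights split as `√O · (√O b)`.) -/
theorem sum_sq_sum_mul_le {ι ι' : Type*} [Fintype ι] [Fintype ι'] (O : ι → ι' → ℝ)
    (hO : ∀ i j, 0 ≤ O i j) {R C : ℝ} (hR0 : 0 ≤ R) (hrow : ∀ i, ∑ j, O i j ≤ R)
    (hcol : ∀ j, ∑ i, O i j ≤ C) (b : ι' → ℝ) :
    ∑ i, (∑ j, O i j * b j) ^ 2 ≤ R * C * ∑ j, b j ^ 2 := by
  -- Row-wise Cauchy–Schwarz: (Σ_j O b)² ≤ (Σ_j O) · (Σ_j O b²) ≤ R · Σ_j O b².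
  have hrowCS : ∀ i, (∑ j, O i j * b j) ^ 2 ≤ R * ∑ j, O i j * b j ^ 2 := by
    intro i
    have hcs := Finset.sum_mul_sq_le_sq_mul_sq (s := Finset.univ)
      (f := fun j => Real.sqrt (O i j)) (g := fun j => Real.sqrt (O i j) * b j)
    have h1 : ∀ j, Real.sqrt (O i j) * (Real.sqrt (O i j) * b j) = O i j * b j := by
      intro j; rw [← mul_assoc, Real.mul_self_sqrt (hO i j)]
    have h2 : ∀ j, Real.sqrt (O i j) ^ 2 = O i j := fun j => Real.sq_sqrt (hO i j)
    have h3 : ∀ j, (Real.sqrt (O i j) * b j) ^ 2 = O i j * b j ^ 2 := by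
      intro j; rw [mul_pow, Real.sq_sqrt (hO i j)]
    simp only [h1, h2, h3] at hcs
    have hnn : 0 ≤ ∑ j, O i j * b j ^ 2 := Finset.sum_nonneg fun j _ => mul_nonneg (hO i j) (sq_nonneg _)
    exact hcs.trans (mul_le_mul_of_nonneg_right (hrow i) hnn)
  calc ∑ i, (∑ j, O i j * b j) ^ 2
      ≤ ∑ i, R * ∑ j, O i j * b j ^ 2 := Finset.sum_le_sum fun i _ => hrowCS i
    _ = R * ∑ j, (∑ i, O i j) * b j ^ 2 := by
        rw [← Finset.mul_sum, Finset.sum_comm]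
        congr 1
        refine Finset.sum_congr rfl fun j _ => ?_
        rw [Finset.sum_mul]
    _ ≤ R * ∑ j, C * b j ^ 2 := by
        refine mul_le_mul_of_nonneg_left (Finset.sum_le_sum fun j _ => ?_) hR0
        exact mul_le_mul_of_nonneg_right (hcol j) (sq_nonneg _)
    _ = R * C * ∑ j, b j ^ 2 := by rw [← Finset.mul_sum, mul_assoc]

/-- `√(R·C) ≤ max R C` for non-negative `R, C`: the Schur constant is below the code's `max (‖O‖₁, ‖O‖_∞)`. -/
theorem sqrt_mul_le_max {R C : ℝ} (hR0 : 0 ≤ R) (hC0 : 0 ≤ C) : Real.sqrt (R * C) ≤ max R C := by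
  have hM : 0 ≤ max R C := le_max_of_le_left hR0
  rw [Real.sqrt_le_left hM, sq]
  exact mul_le_mul (le_max_left _ _) (le_max_right _ _) hC0 hM

section L2

open scoped Matrix.Norms.L2Operator InnerProductSpace

variable {𝕜 : Type*} [RCLike 𝕜]
variable {m n S : Type*} [Fintype m] [Fintype n] [Fintype S]

/-- The Euclidean norm of a coordinate vector, squared, is the sum of the squared moduli of its entries. -/
theorem norm_toLp_sq (f : m → 𝕜) : ‖toLp 2 f‖ ^ 2 = ∑ i, ‖f i‖ ^ 2 := by
  rw [EuclideanSpace.norm_sq_eq]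

/-- From `a² ≤ b²` with `0 ≤ a, b` conclude `a ≤ b` (used for norms). -/
private theorem le_of_sq_le_sq' {a b : ℝ} (ha : 0 ≤ a) (hb : 0 ≤ b) (h : a ^ 2 ≤ b ^ 2) : a ≤ b := by
  have := Real.sqrt_le_sqrt h
  rwa [Real.sqrt_sq ha, Real.sqrt_sq hb] at this

/-- **Schur test, vector form.**  A matrix `B` over `𝕜 = ℝ` or `ℂ` whose absolute row sums are `≤ R` and
absolute column sums `≤ C` maps every vector with `‖B v‖₂ ≤ √(R·C) · ‖v‖₂`. -/
theorem norm_toLp_mulVec_le_of_row_col (B : Matrix m n 𝕜) {R C : ℝ} (hR0 : 0 ≤ R) (hC0 : 0 ≤ C)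
    (hrow : ∀ i, ∑ j, ‖B i j‖ ≤ R) (hcol : ∀ j, ∑ i, ‖B i j‖ ≤ C) (v : EuclideanSpace 𝕜 n) :
    ‖toLp 2 (B *ᵥ ofLp v)‖ ≤ Real.sqrt (R * C) * ‖v‖ := by
  have hsq : ‖toLp 2 (B *ᵥ ofLp v)‖ ^ 2 ≤ (Real.sqrt (R * C) * ‖v‖) ^ 2 := by
    rw [norm_toLp_sq, mul_pow, Real.sq_sqrt (mul_nonneg hR0 hC0), EuclideanSpace.norm_sq_eq]
    calc ∑ i, ‖(B *ᵥ ofLp v) i‖ ^ 2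
        ≤ ∑ i, (∑ j, ‖B i j‖ * ‖v j‖) ^ 2 := by
          refine Finset.sum_le_sum fun i _ => ?_
          have h0 : 0 ≤ ‖(B *ᵥ ofLp v) i‖ := norm_nonneg _
          have h1 : ‖(B *ᵥ ofLp v) i‖ ≤ ∑ j, ‖B i j‖ * ‖v j‖ := by
            simp only [Matrix.mulVec, dotProduct]
            exact (norm_sum_le _ _).trans (le_of_eq (Finset.sum_congr rfl fun j _ => norm_mul _ _))
          exact pow_le_pow_left₀ h0 h1 2
      _ ≤ R * C * ∑ j, ‖v j‖ ^ 2 :=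
          sum_sq_sum_mul_le (fun i j => ‖B i j‖) (fun i j => norm_nonneg _) hR0 hrow hcol _
  exact le_of_sq_le_sq' (norm_nonneg _) (mul_nonneg (Real.sqrt_nonneg _) (norm_nonneg _)) hsq

/-- **Schur test** for the `L²` operator norm: absolute row sums `≤ R` and absolute column sums `≤ C` give
`‖B‖₂ ≤ √(R·C)`.  (`opnorm_bound` of the code returns the weaker `max (R, C)`, cf. `sqrt_mul_le_max`.) -/
theorem l2_opNorm_le_sqrt_row_mul_col [DecidableEq n] (B : Matrix m n 𝕜) {R C : ℝ} (hR0 : 0 ≤ R) (hC0 : 0 ≤ C)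
    (hrow : ∀ i, ∑ j, ‖B i j‖ ≤ R) (hcol : ∀ j, ∑ i, ‖B i j‖ ≤ C) : ‖B‖ ≤ Real.sqrt (R * C) := by
  rw [Matrix.l2_opNorm_def]
  refine ContinuousLinearMap.opNorm_le_bound _ (Real.sqrt_nonneg _) fun v => ?_
  exact norm_toLp_mulVec_le_of_row_col B hR0 hC0 hrow hcol v

/-- Schur test with the code's constant: `‖B‖₂ ≤ max (R, C)`. -/
theorem l2_opNorm_le_max_row_col [DecidableEq n] (B : Matrix m n 𝕜) {R C : ℝ} (hR0 : 0 ≤ R) (hC0 : 0 ≤ C)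
    (hrow : ∀ i, ∑ j, ‖B i j‖ ≤ R) (hcol : ∀ j, ∑ i, ‖B i j‖ ≤ C) : ‖B‖ ≤ max R C :=
  (l2_opNorm_le_sqrt_row_mul_col B hR0 hC0 hrow hcol).trans (sqrt_mul_le_max hR0 hC0)

/-- **Rounding-defect bound.**  A block `D : m × n` whose entries have modulus `≤ ε` (nearest rounding to the grid
`2^(−P)·ℤ` gives `ε = 2^(−P−1)`) has `‖D‖₂ ≤ √(#m · #n) · ε`; for a square `χ × χ` block this is the code's
`ρ = χ · 2^(−P−1)`, and summing `#s′` such blocks of shape `χ_x × χ_{x+1}` in quadrature gives its `ρ¹`. -/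
theorem l2_opNorm_le_of_forall_norm_entry_le [DecidableEq n] (D : Matrix m n 𝕜) {ε : ℝ} (hε : 0 ≤ ε)
    (h : ∀ i j, ‖D i j‖ ≤ ε) : ‖D‖ ≤ Real.sqrt (Fintype.card m * Fintype.card n) * ε := by
  have hrow : ∀ i, ∑ j, ‖D i j‖ ≤ Fintype.card n * ε := fun i =>
    (Finset.sum_le_sum fun j _ => h i j).trans (by simp)
  have hcol : ∀ j, ∑ i, ‖D i j‖ ≤ Fintype.card m * ε := fun j =>
    (Finset.sum_le_sum fun i _ => h i j).trans (by simp)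
  have hn : (0 : ℝ) ≤ Fintype.card n * ε := mul_nonneg (Nat.cast_nonneg _) hε
  have hm : (0 : ℝ) ≤ Fintype.card m * ε := mul_nonneg (Nat.cast_nonneg _) hε
  refine (l2_opNorm_le_sqrt_row_mul_col D hn hm hrow hcol).trans (le_of_eq ?_)
  rw [show (Fintype.card n : ℝ) * ε * (Fintype.card m * ε) = (Fintype.card m * Fintype.card n) * (ε * ε) by
    ring, Real.sqrt_mul (mul_nonneg (Nat.cast_nonneg _) (Nat.cast_nonneg _)), Real.sqrt_mul_self hε]

/-- An entry is bounded by the `L²` operator norm: `‖M i j‖ ≤ ‖M‖₂`.  (For the reader's final `1 × 1`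
environments this turns `‖X̂ − X‖₂ ≤ r` into the enclosures `|B̂ − B| ≤ r_n`, `|ĥ − den·A| ≤ r_h`.) -/
theorem norm_entry_le_l2_opNorm [DecidableEq n] (M : Matrix m n 𝕜) (i : m) (j : n) : ‖M i j‖ ≤ ‖M‖ := by
  have hcoord : (M *ᵥ ofLp (toLp 2 (Pi.single j (1 : 𝕜)) : EuclideanSpace 𝕜 n)) i = M i j := by
    rw [ofLp_toLp, Matrix.mulVec_single_one, Matrix.col_apply]
  have h1 : ‖M i j‖ ≤ ‖toLp 2 (M *ᵥ ofLp (toLp 2 (Pi.single j (1 : 𝕜)) : EuclideanSpace 𝕜 n))‖ := by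
    rw [← hcoord]
    exact PiLp.norm_apply_le (toLp 2 (M *ᵥ ofLp (toLp 2 (Pi.single j (1 : 𝕜)) : EuclideanSpace 𝕜 n))) i
  have h2 : ‖toLp 2 (M *ᵥ ofLp (toLp 2 (Pi.single j (1 : 𝕜)) : EuclideanSpace 𝕜 n))‖
      ≤ ‖M‖ * ‖(toLp 2 (Pi.single j (1 : 𝕜)) : EuclideanSpace 𝕜 n)‖ :=
    Matrix.l2_opNorm_mulVec M (toLp 2 (Pi.single j (1 : 𝕜)))
  have he : ‖(toLp 2 (Pi.single j (1 : 𝕜)) : EuclideanSpace 𝕜 n)‖ = 1 := by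
    rw [PiLp.toLp_single, PiLp.norm_single, norm_one]
  rw [he, mul_one] at h2
  exact h1.trans h2

/-- Enclosure of an entry from an environment radius: `‖X̂ − X‖₂ ≤ r ⟹ ‖X̂ i j − X i j‖ ≤ r`.  For the reader's
real `1 × 1` final environments this is `|B̂ − B| ≤ r_n` and `|ĥ − den·A| ≤ r_h`, the inputs of `accept_sound`. -/
theorem norm_entry_sub_le_of_norm_sub_le [DecidableEq n] {Xh X : Matrix m n 𝕜} {r : ℝ}
    (h : ‖Xh - X‖ ≤ r) (i : m) (j : n) : ‖Xh i j - X i j‖ ≤ r := by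
  rw [← Matrix.sub_apply]
  exact (norm_entry_le_l2_opNorm (Xh - X) i j).trans h

end L2

end Summit.Ventures.CertifiedManyBodySolver.Upper.IntervalReader

end
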